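import Summits.BirchSwinnertonDyer.BirchSwinnertonDyer.Theorems.KimAtThreeDeepLowerOffStratumAdditiveDefectPortTwoExp
import Summits.BirchSwinnertonDyer.BirchSwinnertonDyer.Theorems.KimAtThreeDeepLowerOffStratumAdditiveDefect
import Summits.BirchSwinnertonDyer.BirchSwinnertonDyer.Theorems.KimAtThreeShallowEqDeepSplitGlueNoStub
import HarnessLib

/-!
# Crux `DeepLowerAtThreeOffKatoStratum` (item 19679), stub `stub_additiveDefect`, file 3: the TORSION SPLIT —
# the registered stub VERBATIM from the PRINTED [S24] on the `t = 0` defect rows and ONE displayed residual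
# (R₁) on the `t ≥ 1` rows; S24-DEEP confined to (R₁) — route W2 `KimAtThreeKolyvagin`, cell `bsd-addord`,
# seat `bsd-addord-w2-acc3` (PROGRAMME PART 1b row (3)), gen 3

HONEST FRAMING. TOOL theorems only (no definition, no named fact, no `sorry`); nothing asserted, nothing booked,
no mark moved; crux 19679 stays OPEN (owner = seat w2-c2, who assembles via
`Cruxes.DeepLowerAtThreeOffKatoStratum.Birth.DeepLowerAtThreeOffKatoStratum_of`; its END assembly of record is
`KimAtThreeDeepLowerOffKatoStratumAssemblyEnd`).  Sequel of `KimAtThreeDeepLowerOffStratumAdditiveDefectPortTwoExp`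
(gen 2: §4 every `t` from the S24-DEEP ports, §4′ `t = 0` from printed [S24], §6 the stub GRANTED `hS24d hS24d₂ hGZK
hPT` + the general-`t` port binder `hPort₂`).

WHY.  The route's leaf `N11.KimAtThreeRankZeroPUB` is a `t = 0` statement (`#E(ℚ₃)[3] = 1`), but the crux
`DeepLowerAtThreeOffKatoStratum` — and hence the additive-defect stub, whose defect disjunction has the disjunct
`#E(ℚ₃)[3] ≠ 1` — also quantifies over the `t ≥ 1` rows (they serve the deep statement `N11.KimAtThreeDeepPUB`
only).  In gen 2's §6 the two S24-DEEP ports (FLAG `S24-DEEP-PORT@3`: [S24] Thm. 4.4 (1)(2) on a DEEP Frobenius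
sub-class — a port of Sakamoto's proof, not a printed sentence) are paid on EVERY additive-defect row, although the
`t = 0` rows (Kodaira IV/IV* `3 ∣ c₃`, `3 ∣ c_{D₀}`) need only the PRINTED theorem (§4′).  Through §6 the flag then
enters the owner's END assembly of 19679 and of the parent 19075 (`…AssemblyEnd` §1/§2, binders `hS24d hS24d₂`),
and 19679's port binder (`∀ t, ∃ e`) differs from the twin crux 19599's (`t = 0`, seat acc6's
`KimAtThreeShallowEqDeepOffStratumAdditiveDefectOfPort.stub_additiveDefect_of_portTwoExp`).  This file splits the
stub by the local `3`-torsion: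

* §8 **`stubAdditiveDefect_of_portTwoExp_torsionFree_of_torsionRows`** — TYPE = the registered `stub_additiveDefect`
  of the BC3 birth skeleton (`planner/splitW2L/bc/DeepLowerAtThreeOffKatoStratum_birth.lean`, sha256
  e575d03075635394) VERBATIM, GRANTED: `hS24 hS24₂` = the PRINTED [S24] Thm. 4.4 (1)(2)
  (`Sakamoto2024.kolyvaginSystems_freeRankOne_zmod_three_pow`, `…idealOfBasis_eq_fittingIdeal_zmod_three_pow`, PUB —
  conjunct `SakamotoKolyvaginThree` of the alias 19678 `KatoStratumSharedParts`), GZK, Poitou–Tate, the `t = 0`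
  port binder `hPort₂` = acc6's 19599 binder TOKEN FOR TOKEN (so ONE term feeds both stubs), and (R₁) = the
  19679-row conclusion DISPLAYED on the additive tower rows with `#E(ℚ₃)[3] ≠ 1` only (binders of the stub
  verbatim with the defect disjunction replaced by its torsion disjunct).  Proof: case `#E(ℚ₃)[3] = 1` → the
  disjunction collapses to `3 ∣ c₃ ∨ 3 ∣ c_{D₀}` → §4′; case `≠ 1` → (R₁).
* §9 `torsionRows_of_deepPortsTwoExp` — (R₁) ⟸ {S24-DEEP (1)(2), GZK, Poitou–Tate, PORT₂ on the `t ≥ 1` additive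
  rows} (gen 2's §4 + §5), so NOTHING of gen 2's road is lost: `stubAdditiveDefect_of_portTwoExp_split` recovers the
  stub from the two port binders with S24-DEEP asked only where it is used.
* §10 `torsionRows_of_missingLowerBoundAt_of_tamManinDiv` — (R₁) ⟸ {GZK, Miller's lower half
  `MissingLowerBoundAt W₀ 3`, TamManinDiv∞ `v₃(∏ c_ℓ) + v₃(c_{D₀}) ≤ ∂^{(∞)}_{deep}`} asked on the `t ≥ 1`
  additive rows only (gen 0's socket road `…AdditiveDefect.stubAdditiveDefect_row_of_missingLowerBoundAt_of_tamManinDiv`).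

NET (for the owner / the residual reading): with §8 as the `h₂` of `DeepLowerAtThreeOffKatoStratum_of`, the END
assembly of 19679 / 19075 needs NO S24-DEEP port on any `t = 0` row (19678's printed [S24] suffices), displays the
SAME port term as 19599, and carries the `t ≥ 1` additive rows as ONE displayed line (R₁) whose two reductions are
§9 / §10.  What is NOT here: any discharge of `hPort₂` (seat acc6 gen 2's two-exponent ★ PK-6₂ twin), the
non-additive rows (seats acc2 / w2-c2), the owner's assembly.
References: [Kim2025RefinedTNC] Thm 1.1, §8.1.2; [Kim2022StructureSelmer] Thm. 1.9 (6), Thm. 3.13, Conj. 1.10;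
[Sakamoto2024] Thm. 4.4 (1)(2) (p. 926); [MazurRubin2004] Thm. 5.2.12, Prop. A.2; [MilneADT2006] I Thm. 4.10;
[Miller2011LMS] Def. 1.1; cell memo `run/shared/lean/pub/bsd-addord/kim3/KIM3-PROOF.md` §14, §16, §19.
-/

set_option autoImplicit false
-- the Theorems namespace of a single-conjunct summit repeats the summit name by design (D-0017)
set_option linter.dupNamespace false

noncomputable section

open scoped Classical NumberField ContRepresentation
open Function Field NumberField IsDedekindDomain IsDedekindDomain.HeightOneSpectrum WeierstrassCurve
  CongruenceSubgroup
  Literature.NumberTheory.EllipticCurves Literature.NumberTheory.EllipticCurves.ModularForms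
  Literature.NumberTheory.EllipticCurves.Rank1Residual
  Literature.NumberTheory.EllipticCurves.Rank1Residual.Typed
  Literature.NumberTheory.GaloisRepresentations
  Literature.NumberTheory.GaloisRepresentations.DiscreteGaloisModule Literature.NumberTheory.GaloisCohomology
  Rat.HeightOneSpectrum
  Summit.BirchSwinnertonDyer.Rank1Residual.GaloisImage
  Summit.BirchSwinnertonDyer.Rank1Residual.GaloisImage.S24Deep
  Summit.BirchSwinnertonDyer.Rank1Residual.X4
  Summit.BirchSwinnertonDyer.BirchSwinnertonDyer.Theorems.KimAtThreeKolyvaginDefs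
  Summit.BirchSwinnertonDyer.BirchSwinnertonDyer.Theorems.KimAtThreeDeepLowerOffStratumAdditiveDefectPortTwoExp
  Summit.BirchSwinnertonDyer.BirchSwinnertonDyer.Theorems.KimAtThreeDeepLowerOffStratumAdditiveDefect
  Summit.BirchSwinnertonDyer.BirchSwinnertonDyer.Theorems.KimAtThreeDeepLowerNonAdditiveRows
  Summit.BirchSwinnertonDyer.BirchSwinnertonDyer.Theorems.KimAtThreeShallowEqDeepSplitGlueNoStub

namespace Summit.BirchSwinnertonDyer.BirchSwinnertonDyer.Theorems.KimAtThreeDeepLowerOffStratumAdditiveDefectTorsionSplit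

/-! ### §8 The registered stub from the PRINTED [S24] on `t = 0` rows and ONE displayed residual (R₁) on `t ≥ 1` rows -/

/-- **`stub_additiveDefect` of the BC3 birth skeleton of crux 19679 (`DeepLowerAtThreeOffKatoStratum`), TYPE
VERBATIM, split by the local `3`-torsion.**  GRANTED (nothing asserted): the PRINTED [S24] Thm. 4.4 (1)(2)
`hS24`/`hS24₂` (PUB; NOT the S24-DEEP ports), GZK `hGZK`, Poitou–Tate `hPT`; the `t = 0` port binder `hPort₂` —
for every tower-surjective `W` ADDITIVE at `3` with `#E(ℚ₃)[3] = 1`, every place `v₃ ∣ 3`, generator family `η`,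
lattice-optimal datum `P` at the conductor with `3 ∣ c₃ ∨ 3 ∣ c_P`, SOME exponent `e` with
`KatoKuriharaPortThreeAtWith₂TwoExp W 0 e v₃ η P` (= seat acc6's binder of
`KimAtThreeShallowEqDeepOffStratumAdditiveDefectOfPort.stub_additiveDefect_of_portTwoExp` for the twin crux 19599,
token for token; FLAG `K22-Thm3.13-PORT@3`; in print `e = v₃(c₃) + v₃(c_P)`); and the residual (R₁) `hTors` —
the conclusion of crux 19679 on the additive optimal tower rows of analytic rank `0` with `#E(ℚ₃)[3] ≠ 1`
(`t ≥ 1`; outside the `t = 0` leaf `N11.KimAtThreeRankZeroPUB`), binders of the stub verbatim.  Proof: on a row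
with `#E(ℚ₃)[3] = 1` the defect disjunction is `3 ∣ c₃ ∨ 3 ∣ c_{D₀}` and gen 2's §4′
`deepLower_datum_of_portTwoExp_torsionFree` (printed [S24] via acc6's all-levels inequality + all-levels `≤` deep)
applies at a constructed place `v₃` and generator family `η`; otherwise (R₁).  Composition with the skeleton's
`DeepLowerAtThreeOffKatoStratum_of` is by `exact` on this type.  Crux 19679 stays OPEN; nothing booked.
[cite: Kim2025RefinedTNC, Thm 1.1 and §8.1.2] [cite: Kim2022StructureSelmer, Thm. 1.9 (6), Thm. 3.13]
[cite: Sakamoto2024, Thm. 4.4 (1)(2) (p. 926)] [cite: MazurRubin2004, Thm. 5.2.12] [cite: MilneADT2006, Ch. I, Thm. 4.10] -/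
theorem stubAdditiveDefect_of_portTwoExp_torsionFree_of_torsionRows
    (hS24 : Sakamoto2024.kolyvaginSystems_freeRankOne_zmod_three_pow)
    (hS24₂ : Sakamoto2024.kolyvaginSystems_idealOfBasis_eq_fittingIdeal_zmod_three_pow)
    (hGZK : rank_eq_analyticRank_of_analyticRank_le_one)
    (hPT : poitouTate_selmerStructure_duality ℚ)
    (hPort₂ : ∀ (W : WeierstrassCurve ℚ) [W.IsElliptic] [W.IsGloballyMinimal],
      (∀ m : ℕ, W.HasSurjectiveModNGaloisRep (3 ^ m : ℕ)) →
      (haveI : Fact (Nat.Prime 3) := ⟨Nat.prime_three⟩; Addv W 3) →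
      Nat.card {Q : (W.baseChange ℚ_[3]).toAffine.Point // (3 : ℕ) • Q = 0} = 1 →
      ∀ (v₃ : HeightOneSpectrum (𝓞 ℚ)), ((3 : ℕ) : 𝓞 ℚ) ∈ v₃.asIdeal →
      ∀ (η : (q : HeightOneSpectrum (𝓞 ℚ)) → (ZMod (Ideal.absNorm q.asIdeal))ˣ),
        (∀ q, Subgroup.zpowers (η q) = ⊤) →
      ∀ {N : ℕ} [NeZero N] (P : ModularParametrizationData W N), N = W.conductorNorm ℤ →
        (∀ z ∈ P.L.lattice, ∃ w ∈ periodLattice P.f, z = P.c * w) →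
        (3 ∣ (W.baseChange ℚ_[3]).localTamagawaNumber ℤ_[3] ∨ (3 : ℤ) ∣ P.maninConstant) →
          ∃ e : ℕ, KatoKuriharaPortThreeAtWith₂TwoExp W 0 e v₃ η P)
    (hTors : ∀ (W₀ : WeierstrassCurve ℚ) [W₀.IsElliptic] [W₀.IsGloballyMinimal],
      (∀ n : ℕ, W₀.HasSurjectiveModNGaloisRep (3 ^ n : ℕ)) → Finite W₀.sha →
      ∀ {N : ℕ} [NeZero N], N = W₀.conductorNorm ℤ →
      ∀ (D₀ : ModularParametrizationData W₀ N),
        (∀ z ∈ D₀.L.lattice, ∃ w ∈ periodLattice D₀.f, z = D₀.c * w) →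
        (∀ (W₂ : WeierstrassCurve ℚ) [W₂.IsElliptic] (D₂ : ModularParametrizationData W₂ N),
          D₂.f = D₀.f → D₀.modularDegree ≤ D₂.modularDegree) →
        (∀ r : ℚ, ratPlusSymbol D₀.f r ≠ 0 → 0 ≤ padicValRat 3 (ratPlusSymbol D₀.f r)) →
        kuriharaVanishingOrder W₀ 3 D₀.f = 0 →
        (haveI : Fact (Nat.Prime 3) := ⟨Nat.prime_three⟩; Addv W₀ 3) →
        Nat.card {Q : (W₀.baseChange ℚ_[3]).toAffine.Point // (3 : ℕ) • Q = 0} ≠ 1 →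
        ∃ d : ℕ, kuriharaPartialDeepInfty W₀ 3 D₀.f = d ∧
          kuriharaPartial W₀ 3 D₀.f 0 ≤
            ((padicValNat 3 (Nat.card (AddCommGroup.primaryComponent W₀.sha 3)) + d : ℕ) : ℕ∞)) :
    ∀ (W₀ : WeierstrassCurve ℚ) [W₀.IsElliptic] [W₀.IsGloballyMinimal],
      (∀ n : ℕ, W₀.HasSurjectiveModNGaloisRep (3 ^ n : ℕ)) → Finite W₀.sha →
      ∀ {N : ℕ} [NeZero N], N = W₀.conductorNorm ℤ →
      ∀ (D₀ : Literature.NumberTheory.EllipticCurves.ModularForms.ModularParametrizationData W₀ N),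
        (∀ z ∈ D₀.L.lattice, ∃ w ∈ Literature.NumberTheory.EllipticCurves.ModularForms.periodLattice D₀.f, z = D₀.c * w) →
        (∀ (W₂ : WeierstrassCurve ℚ) [W₂.IsElliptic]
          (D₂ : Literature.NumberTheory.EllipticCurves.ModularForms.ModularParametrizationData W₂ N),
          D₂.f = D₀.f → D₀.modularDegree ≤ D₂.modularDegree) →
        (∀ r : ℚ, Literature.NumberTheory.EllipticCurves.ratPlusSymbol D₀.f r ≠ 0 →
          0 ≤ padicValRat 3 (Literature.NumberTheory.EllipticCurves.ratPlusSymbol D₀.f r)) →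
        Literature.NumberTheory.EllipticCurves.kuriharaVanishingOrder W₀ 3 D₀.f = 0 →
        (haveI : Fact (Nat.Prime 3) := ⟨Nat.prime_three⟩;
            Literature.NumberTheory.EllipticCurves.Rank1Residual.Addv W₀ 3) →
        (3 ∣ (W₀.baseChange ℚ_[3]).localTamagawaNumber ℤ_[3] ∨
          Nat.card {Q : (W₀.baseChange ℚ_[3]).toAffine.Point // (3 : ℕ) • Q = 0} ≠ 1 ∨
          (3 : ℤ) ∣ D₀.maninConstant) →
        ∃ d : ℕ, Literature.NumberTheory.EllipticCurves.kuriharaPartialDeepInfty W₀ 3 D₀.f = d ∧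
          Literature.NumberTheory.EllipticCurves.kuriharaPartial W₀ 3 D₀.f 0 ≤
            ((padicValNat 3 (Nat.card (AddCommGroup.primaryComponent W₀.sha 3)) + d : ℕ) : ℕ∞) := by
  intro W₀ _ _ htow hfin N _ hN D₀ hopt hdeg hint hord hA hdef
  haveI : Fact (Nat.Prime 3) := ⟨Nat.prime_three⟩
  by_cases ht : Nat.card {Q : (W₀.baseChange ℚ_[3]).toAffine.Point // (3 : ℕ) • Q = 0} = 1
  · -- a `t = 0` defect row: the disjunction is `3 ∣ c₃ ∨ 3 ∣ c_{D₀}`; printed [S24] through gen 2's §4′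
    have hdef' : 3 ∣ (W₀.baseChange ℚ_[3]).localTamagawaNumber ℤ_[3] ∨ (3 : ℤ) ∣ D₀.maninConstant := by
      rcases hdef with h | h | h
      · exact Or.inl h
      · exact absurd ht h
      · exact Or.inr h
    obtain ⟨v₃, η, hv₃, hη⟩ := exists_place_three_and_generators
    obtain ⟨e, hPort⟩ := hPort₂ W₀ htow hA ht v₃ hv₃ η hη D₀ hN hopt hdef'
    exact deepLower_datum_of_portTwoExp_torsionFree hS24 hS24₂ hGZK hPT W₀ e hA htow ht hN D₀ v₃ hv₃ η hη
      hPort hord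
  · -- a `t ≥ 1` row: the displayed residual (R₁)
    exact hTors W₀ htow hfin hN D₀ hopt hdeg hint hord hA ht

/-! ### §9 (R₁) from the S24-DEEP ports and PORT₂ on the `t ≥ 1` rows (gen 2's road, confined) -/

/-- **(R₁) ⟸ {S24-DEEP (1)(2), GZK, Poitou–Tate, PORT₂ on the `t ≥ 1` additive rows}.**  The port binder
`hPort₂'` is gen 2's general-`t` PORT₂-SHARED-on-defect-rows binder RESTRICTED to the rows with `#E(ℚ₃)[3] ≠ 1`
(`∀ t`, `#E(ℚ₃)[3] = 3^t`, `≠ 1`, `∃ e`); `t` exists on every row (`exists_natCard_threeTorsion_eq_three_pow`), a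
place `v₃ ∣ 3` and generators `η` are constructed, then gen 2's §4 `deepLower_datum_of_deepPortsTwoExp`.  So the
S24-DEEP flag is paid ONLY on the `t ≥ 1` rows.  Nothing asserted. [cite: Kim2022StructureSelmer, Thm. 1.9 (6), Thm. 3.13]
[cite: Sakamoto2024, Thm. 4.4 (p. 926); §2, Lemma 5.2, Cor. 5.5 — the deep sub-class is a PORT] [cite: MazurRubin2004, Thm. 5.2.12, Prop. A.2] -/
theorem torsionRows_of_deepPortsTwoExp
    (hS24d : S24Deep.kolyvaginSystems_freeRankOne_zmod_three_pow_deep)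
    (hS24d₂ : S24Deep.kolyvaginSystems_idealOfBasis_eq_fittingIdeal_zmod_three_pow_deep)
    (hGZK : rank_eq_analyticRank_of_analyticRank_le_one)
    (hPT : poitouTate_selmerStructure_duality ℚ)
    (hPort₂' : ∀ (W : WeierstrassCurve ℚ) [W.IsElliptic] [W.IsGloballyMinimal],
      (∀ m : ℕ, W.HasSurjectiveModNGaloisRep (3 ^ m : ℕ)) →
      (haveI : Fact (Nat.Prime 3) := ⟨Nat.prime_three⟩; Addv W 3) →
      ∀ t : ℕ, Nat.card {Q : (W.baseChange ℚ_[3]).toAffine.Point // (3 : ℕ) • Q = 0} = 3 ^ t →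
      Nat.card {Q : (W.baseChange ℚ_[3]).toAffine.Point // (3 : ℕ) • Q = 0} ≠ 1 →
      ∀ (v₃ : HeightOneSpectrum (𝓞 ℚ)), ((3 : ℕ) : 𝓞 ℚ) ∈ v₃.asIdeal →
      ∀ (η : (q : HeightOneSpectrum (𝓞 ℚ)) → (ZMod (Ideal.absNorm q.asIdeal))ˣ),
        (∀ q, Subgroup.zpowers (η q) = ⊤) →
      ∀ {N : ℕ} [NeZero N] (P : ModularParametrizationData W N), N = W.conductorNorm ℤ →
        (∀ z ∈ P.L.lattice, ∃ w ∈ periodLattice P.f, z = P.c * w) →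
          ∃ e : ℕ, KatoKuriharaPortThreeAtWith₂TwoExp W t e v₃ η P) :
    ∀ (W₀ : WeierstrassCurve ℚ) [W₀.IsElliptic] [W₀.IsGloballyMinimal],
      (∀ n : ℕ, W₀.HasSurjectiveModNGaloisRep (3 ^ n : ℕ)) → Finite W₀.sha →
      ∀ {N : ℕ} [NeZero N], N = W₀.conductorNorm ℤ →
      ∀ (D₀ : ModularParametrizationData W₀ N),
        (∀ z ∈ D₀.L.lattice, ∃ w ∈ periodLattice D₀.f, z = D₀.c * w) →
        (∀ (W₂ : WeierstrassCurve ℚ) [W₂.IsElliptic] (D₂ : ModularParametrizationData W₂ N),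
          D₂.f = D₀.f → D₀.modularDegree ≤ D₂.modularDegree) →
        (∀ r : ℚ, ratPlusSymbol D₀.f r ≠ 0 → 0 ≤ padicValRat 3 (ratPlusSymbol D₀.f r)) →
        kuriharaVanishingOrder W₀ 3 D₀.f = 0 →
        (haveI : Fact (Nat.Prime 3) := ⟨Nat.prime_three⟩; Addv W₀ 3) →
        Nat.card {Q : (W₀.baseChange ℚ_[3]).toAffine.Point // (3 : ℕ) • Q = 0} ≠ 1 →
        ∃ d : ℕ, kuriharaPartialDeepInfty W₀ 3 D₀.f = d ∧
          kuriharaPartial W₀ 3 D₀.f 0 ≤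
            ((padicValNat 3 (Nat.card (AddCommGroup.primaryComponent W₀.sha 3)) + d : ℕ) : ℕ∞) := by
  intro W₀ _ _ htow _ N _ hN D₀ hopt _ _ hord hA ht1
  haveI : Fact (Nat.Prime 3) := ⟨Nat.prime_three⟩
  obtain ⟨t, ht⟩ := exists_natCard_threeTorsion_eq_three_pow W₀
  obtain ⟨v₃, η, hv₃, hη⟩ := exists_place_three_and_generators
  obtain ⟨e, hPort⟩ := hPort₂' W₀ htow hA t ht ht1 v₃ hv₃ η hη D₀ hN hopt
  exact deepLower_datum_of_deepPortsTwoExp hS24d hS24d₂ hGZK hPT W₀ t e hA htow ht hN D₀ v₃ hv₃ η hη hPort hord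

/-- **Nothing of gen 2's road is lost**: the registered stub from the PRINTED [S24] + the `t = 0` port binder on
the `t = 0` rows and the S24-DEEP ports + the `t ≥ 1` port binder on the `t ≥ 1` rows (§8 ∘ §9).  Gen 2's single
general-`t` binder `hPort₂` of `stubAdditiveDefect_of_portTwoExp` yields both restricted binders (its `t = 0`
instance is `portTwoExpSharedDefect_torsionFree_of_portTwoExpSharedDefect`). Nothing asserted.
[cite: Kim2022StructureSelmer, Thm. 3.13] [cite: Sakamoto2024, Thm. 4.4 (p. 926)] -/
theorem stubAdditiveDefect_of_portTwoExp_split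
    (hS24 : Sakamoto2024.kolyvaginSystems_freeRankOne_zmod_three_pow)
    (hS24₂ : Sakamoto2024.kolyvaginSystems_idealOfBasis_eq_fittingIdeal_zmod_three_pow)
    (hS24d : S24Deep.kolyvaginSystems_freeRankOne_zmod_three_pow_deep)
    (hS24d₂ : S24Deep.kolyvaginSystems_idealOfBasis_eq_fittingIdeal_zmod_three_pow_deep)
    (hGZK : rank_eq_analyticRank_of_analyticRank_le_one)
    (hPT : poitouTate_selmerStructure_duality ℚ)
    (hPort₂ : ∀ (W : WeierstrassCurve ℚ) [W.IsElliptic] [W.IsGloballyMinimal],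
      (∀ m : ℕ, W.HasSurjectiveModNGaloisRep (3 ^ m : ℕ)) →
      (haveI : Fact (Nat.Prime 3) := ⟨Nat.prime_three⟩; Addv W 3) →
      Nat.card {Q : (W.baseChange ℚ_[3]).toAffine.Point // (3 : ℕ) • Q = 0} = 1 →
      ∀ (v₃ : HeightOneSpectrum (𝓞 ℚ)), ((3 : ℕ) : 𝓞 ℚ) ∈ v₃.asIdeal →
      ∀ (η : (q : HeightOneSpectrum (𝓞 ℚ)) → (ZMod (Ideal.absNorm q.asIdeal))ˣ),
        (∀ q, Subgroup.zpowers (η q) = ⊤) →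
      ∀ {N : ℕ} [NeZero N] (P : ModularParametrizationData W N), N = W.conductorNorm ℤ →
        (∀ z ∈ P.L.lattice, ∃ w ∈ periodLattice P.f, z = P.c * w) →
        (3 ∣ (W.baseChange ℚ_[3]).localTamagawaNumber ℤ_[3] ∨ (3 : ℤ) ∣ P.maninConstant) →
          ∃ e : ℕ, KatoKuriharaPortThreeAtWith₂TwoExp W 0 e v₃ η P)
    (hPort₂' : ∀ (W : WeierstrassCurve ℚ) [W.IsElliptic] [W.IsGloballyMinimal],
      (∀ m : ℕ, W.HasSurjectiveModNGaloisRep (3 ^ m : ℕ)) →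
      (haveI : Fact (Nat.Prime 3) := ⟨Nat.prime_three⟩; Addv W 3) →
      ∀ t : ℕ, Nat.card {Q : (W.baseChange ℚ_[3]).toAffine.Point // (3 : ℕ) • Q = 0} = 3 ^ t →
      Nat.card {Q : (W.baseChange ℚ_[3]).toAffine.Point // (3 : ℕ) • Q = 0} ≠ 1 →
      ∀ (v₃ : HeightOneSpectrum (𝓞 ℚ)), ((3 : ℕ) : 𝓞 ℚ) ∈ v₃.asIdeal →
      ∀ (η : (q : HeightOneSpectrum (𝓞 ℚ)) → (ZMod (Ideal.absNorm q.asIdeal))ˣ),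
        (∀ q, Subgroup.zpowers (η q) = ⊤) →
      ∀ {N : ℕ} [NeZero N] (P : ModularParametrizationData W N), N = W.conductorNorm ℤ →
        (∀ z ∈ P.L.lattice, ∃ w ∈ periodLattice P.f, z = P.c * w) →
          ∃ e : ℕ, KatoKuriharaPortThreeAtWith₂TwoExp W t e v₃ η P) :
    ∀ (W₀ : WeierstrassCurve ℚ) [W₀.IsElliptic] [W₀.IsGloballyMinimal],
      (∀ n : ℕ, W₀.HasSurjectiveModNGaloisRep (3 ^ n : ℕ)) → Finite W₀.sha →
      ∀ {N : ℕ} [NeZero N], N = W₀.conductorNorm ℤ →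
      ∀ (D₀ : Literature.NumberTheory.EllipticCurves.ModularForms.ModularParametrizationData W₀ N),
        (∀ z ∈ D₀.L.lattice, ∃ w ∈ Literature.NumberTheory.EllipticCurves.ModularForms.periodLattice D₀.f, z = D₀.c * w) →
        (∀ (W₂ : WeierstrassCurve ℚ) [W₂.IsElliptic]
          (D₂ : Literature.NumberTheory.EllipticCurves.ModularForms.ModularParametrizationData W₂ N),
          D₂.f = D₀.f → D₀.modularDegree ≤ D₂.modularDegree) →
        (∀ r : ℚ, Literature.NumberTheory.EllipticCurves.ratPlusSymbol D₀.f r ≠ 0 →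
          0 ≤ padicValRat 3 (Literature.NumberTheory.EllipticCurves.ratPlusSymbol D₀.f r)) →
        Literature.NumberTheory.EllipticCurves.kuriharaVanishingOrder W₀ 3 D₀.f = 0 →
        (haveI : Fact (Nat.Prime 3) := ⟨Nat.prime_three⟩;
            Literature.NumberTheory.EllipticCurves.Rank1Residual.Addv W₀ 3) →
        (3 ∣ (W₀.baseChange ℚ_[3]).localTamagawaNumber ℤ_[3] ∨
          Nat.card {Q : (W₀.baseChange ℚ_[3]).toAffine.Point // (3 : ℕ) • Q = 0} ≠ 1 ∨
          (3 : ℤ) ∣ D₀.maninConstant) →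
        ∃ d : ℕ, Literature.NumberTheory.EllipticCurves.kuriharaPartialDeepInfty W₀ 3 D₀.f = d ∧
          Literature.NumberTheory.EllipticCurves.kuriharaPartial W₀ 3 D₀.f 0 ≤
            ((padicValNat 3 (Nat.card (AddCommGroup.primaryComponent W₀.sha 3)) + d : ℕ) : ℕ∞) :=
  stubAdditiveDefect_of_portTwoExp_torsionFree_of_torsionRows hS24 hS24₂ hGZK hPT hPort₂
    (torsionRows_of_deepPortsTwoExp hS24d hS24d₂ hGZK hPT hPort₂')

/-- **Gen 2's general-`t` binder restricts to the `t ≥ 1` binder of §9** (forget the defect disjunction, which the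
torsion disjunct supplies). Together with `portTwoExpSharedDefect_torsionFree_of_portTwoExpSharedDefect` (its `t = 0`
instance) this shows `stubAdditiveDefect_of_portTwoExp_split` asks no more than gen 2's §6. [cite: Kim2022StructureSelmer, Thm. 3.13] -/
theorem portTwoExpTorsionRows_of_portTwoExpSharedDefect
    (hPort₂ : ∀ (W : WeierstrassCurve ℚ) [W.IsElliptic] [W.IsGloballyMinimal],
      (∀ m : ℕ, W.HasSurjectiveModNGaloisRep (3 ^ m : ℕ)) →
      (haveI : Fact (Nat.Prime 3) := ⟨Nat.prime_three⟩; Addv W 3) →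
      ∀ t : ℕ, Nat.card {Q : (W.baseChange ℚ_[3]).toAffine.Point // (3 : ℕ) • Q = 0} = 3 ^ t →
      ∀ (v₃ : HeightOneSpectrum (𝓞 ℚ)), ((3 : ℕ) : 𝓞 ℚ) ∈ v₃.asIdeal →
      ∀ (η : (q : HeightOneSpectrum (𝓞 ℚ)) → (ZMod (Ideal.absNorm q.asIdeal))ˣ),
        (∀ q, Subgroup.zpowers (η q) = ⊤) →
      ∀ {N : ℕ} [NeZero N] (P : ModularParametrizationData W N), N = W.conductorNorm ℤ →
        (∀ z ∈ P.L.lattice, ∃ w ∈ periodLattice P.f, z = P.c * w) →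
        (3 ∣ (W.baseChange ℚ_[3]).localTamagawaNumber ℤ_[3] ∨
          Nat.card {Q : (W.baseChange ℚ_[3]).toAffine.Point // (3 : ℕ) • Q = 0} ≠ 1 ∨
          (3 : ℤ) ∣ P.maninConstant) →
        ∃ e : ℕ, KatoKuriharaPortThreeAtWith₂TwoExp W t e v₃ η P) :
    ∀ (W : WeierstrassCurve ℚ) [W.IsElliptic] [W.IsGloballyMinimal],
      (∀ m : ℕ, W.HasSurjectiveModNGaloisRep (3 ^ m : ℕ)) →
      (haveI : Fact (Nat.Prime 3) := ⟨Nat.prime_three⟩; Addv W 3) →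
      ∀ t : ℕ, Nat.card {Q : (W.baseChange ℚ_[3]).toAffine.Point // (3 : ℕ) • Q = 0} = 3 ^ t →
      Nat.card {Q : (W.baseChange ℚ_[3]).toAffine.Point // (3 : ℕ) • Q = 0} ≠ 1 →
      ∀ (v₃ : HeightOneSpectrum (𝓞 ℚ)), ((3 : ℕ) : 𝓞 ℚ) ∈ v₃.asIdeal →
      ∀ (η : (q : HeightOneSpectrum (𝓞 ℚ)) → (ZMod (Ideal.absNorm q.asIdeal))ˣ),
        (∀ q, Subgroup.zpowers (η q) = ⊤) →
      ∀ {N : ℕ} [NeZero N] (P : ModularParametrizationData W N), N = W.conductorNorm ℤ →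
        (∀ z ∈ P.L.lattice, ∃ w ∈ periodLattice P.f, z = P.c * w) →
          ∃ e : ℕ, KatoKuriharaPortThreeAtWith₂TwoExp W t e v₃ η P :=
  fun W _ _ htow hA t ht ht1 v₃ hv₃ η hη _ _ P hN hopt =>
    hPort₂ W htow hA t ht v₃ hv₃ η hη P hN hopt (Or.inr (Or.inl ht1))

/-! ### §10 (R₁) from Miller's lower half and TamManinDiv∞ on the `t ≥ 1` rows (gen 0's socket road, confined) -/

/-- **(R₁) ⟸ {GZK, Miller's LOWER half `MissingLowerBoundAt W₀ 3`, TamManinDiv∞} on the `t ≥ 1` additive rows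
only.**  `hLow`: the lower half of BSD₃ (`ord₃ #Ш_an ≤ ord₃ #Ш`, [Miller2011LMS] Def. 1.1; on additive rows of
analytic rank `0` it is OPEN — K1's leaves / `N10.LowerHalfM` / `PotGoodLowerHalfRankZero` by name, gen 0's
`missingLowerBoundAt_of_addv_of_lowerHalves`) and `hTMD`: `v₃(∏ c_ℓ) + v₃(c_{D₀}) ≤ ∂^{(∞)}_{deep}(δ̃_{D₀.f})`
(Kim's Conj. 1.10 `≥`-half, deep reading, tree normalisation — displayed, never a fact), both asked ONLY on the
additive optimal tower rows of analytic rank `0` with `#E(ℚ₃)[3] ≠ 1`; then gen 0's row theorem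
`stubAdditiveDefect_row_of_missingLowerBoundAt_of_tamManinDiv`.  Nothing asserted.
[cite: Miller2011LMS, Def. 1.1] [cite: Kim2022StructureSelmer, Conj. 1.10 (PDF p. 8), Thm. 1.9 (6)] -/
theorem torsionRows_of_missingLowerBoundAt_of_tamManinDiv
    (hGZK : rank_eq_analyticRank_of_analyticRank_le_one)
    (hLow : ∀ (W₀ : WeierstrassCurve ℚ) [W₀.IsElliptic] [W₀.IsGloballyMinimal],
      (∀ n : ℕ, W₀.HasSurjectiveModNGaloisRep (3 ^ n : ℕ)) → W₀.analyticRank = 0 →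
      (haveI : Fact (Nat.Prime 3) := ⟨Nat.prime_three⟩; Addv W₀ 3) →
      Nat.card {Q : (W₀.baseChange ℚ_[3]).toAffine.Point // (3 : ℕ) • Q = 0} ≠ 1 → MissingLowerBoundAt W₀ 3)
    (hTMD : ∀ (W₀ : WeierstrassCurve ℚ) [W₀.IsElliptic] [W₀.IsGloballyMinimal],
      (∀ n : ℕ, W₀.HasSurjectiveModNGaloisRep (3 ^ n : ℕ)) →
      ∀ {N : ℕ} [NeZero N], N = W₀.conductorNorm ℤ → ∀ (D₀ : ModularParametrizationData W₀ N),
        (∀ z ∈ D₀.L.lattice, ∃ w ∈ periodLattice D₀.f, z = D₀.c * w) →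
        (∀ (W₂ : WeierstrassCurve ℚ) [W₂.IsElliptic] (D₂ : ModularParametrizationData W₂ N),
          D₂.f = D₀.f → D₀.modularDegree ≤ D₂.modularDegree) →
        kuriharaVanishingOrder W₀ 3 D₀.f = 0 →
        (haveI : Fact (Nat.Prime 3) := ⟨Nat.prime_three⟩; Addv W₀ 3) →
        Nat.card {Q : (W₀.baseChange ℚ_[3]).toAffine.Point // (3 : ℕ) • Q = 0} ≠ 1 →
        ((padicValNat 3 W₀.tamagawaProduct + padicValInt 3 D₀.maninConstant : ℕ) : ℕ∞) ≤
          kuriharaPartialDeepInfty W₀ 3 D₀.f) :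
    ∀ (W₀ : WeierstrassCurve ℚ) [W₀.IsElliptic] [W₀.IsGloballyMinimal],
      (∀ n : ℕ, W₀.HasSurjectiveModNGaloisRep (3 ^ n : ℕ)) → Finite W₀.sha →
      ∀ {N : ℕ} [NeZero N], N = W₀.conductorNorm ℤ →
      ∀ (D₀ : ModularParametrizationData W₀ N),
        (∀ z ∈ D₀.L.lattice, ∃ w ∈ periodLattice D₀.f, z = D₀.c * w) →
        (∀ (W₂ : WeierstrassCurve ℚ) [W₂.IsElliptic] (D₂ : ModularParametrizationData W₂ N),
          D₂.f = D₀.f → D₀.modularDegree ≤ D₂.modularDegree) →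
        (∀ r : ℚ, ratPlusSymbol D₀.f r ≠ 0 → 0 ≤ padicValRat 3 (ratPlusSymbol D₀.f r)) →
        kuriharaVanishingOrder W₀ 3 D₀.f = 0 →
        (haveI : Fact (Nat.Prime 3) := ⟨Nat.prime_three⟩; Addv W₀ 3) →
        Nat.card {Q : (W₀.baseChange ℚ_[3]).toAffine.Point // (3 : ℕ) • Q = 0} ≠ 1 →
        ∃ d : ℕ, kuriharaPartialDeepInfty W₀ 3 D₀.f = d ∧
          kuriharaPartial W₀ 3 D₀.f 0 ≤
            ((padicValNat 3 (Nat.card (AddCommGroup.primaryComponent W₀.sha 3)) + d : ℕ) : ℕ∞) := by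
  intro W₀ _ _ htow hfin N _ hN D₀ hopt hdeg hint hord hA ht1
  haveI : Fact (Nat.Prime 3) := ⟨Nat.prime_three⟩
  have hr0 : W₀.analyticRank = 0 :=
    analyticRank_eq_zero_of_kuriharaVanishingOrder_eq_zero W₀ D₀.f D₀.isNewformOf hord
  exact stubAdditiveDefect_row_of_missingLowerBoundAt_of_tamManinDiv hGZK W₀ htow hfin hN D₀ hopt hdeg hint hord
    hA (Or.inr (Or.inl ht1)) (hLow W₀ htow hr0 hA ht1) (hTMD W₀ htow hN D₀ hopt hdeg hord hA ht1)

end Summit.BirchSwinnertonDyer.BirchSwinnertonDyer.Theorems.KimAtThreeDeepLowerOffStratumAdditiveDefectTorsionSplit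

end
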